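import Mathlib
import Summits.ValiantsHypothesis.ValiantsHypothesis.Theorems.RigidityForcesSymmetryRankRigidMinimalReprLaplaceResidualFibre
import Summits.ValiantsHypothesis.ValiantsHypothesis.Theorems.RigidityForcesSymmetryRankRigidMinimalReprLaplaceResidualTools
import Summits.ValiantsHypothesis.ValiantsHypothesis.Theorems.RigidityForcesSymmetryRankRigidMinimalReprLaplaceFiveCoreCertified
import Summits.ValiantsHypothesis.ValiantsHypothesis.Theorems.RigidityForcesSymmetryRankRigidMinimalReprLaplaceSupportCore

/-!
# `LaplaceOptimalFive`, the residual triangle configuration: CASE 1 (a slice vector that is not a letter indicator)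
# (crux `RankRigidMinimalRepr`, stmt-ValiantsHypothesis-18034; frontier rung `LaplaceOptimalFive`, stmt-24813)

The first of the four residual sorted labelled configurations of `laplace_five_three_slices_residual`
(`…LaplaceFiveAtMostTwoSlices.lean`): slices on the slots `0, 1, 2`, pair cuts `{0,1}, {0,2}, {1,2}`.  This file proves it
impossible under the CASE-1 hypothesis of the blueprint (evidence note NOTE-p8g11-24813 §v3): the slice vector `α₀` at slot
`0` admits an orthogonal covector with ALL FIVE coordinates non-zero (i.e. `α₀` is zero or has at least two non-zero
letters).  Dual witness: `φ₀` that covector; `φ₁ ⊥ β` killing the cut `{0,1}` on its 2-slot side, with three non-zero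
coordinates (`exists_orthogonal_support_three`); two independent candidates in `V₂ = γ^⊥ ∩ ({0,2}-kill)^⊥`; by LEMMA Z
(`lemmaZ`) and the `2 × 2` core (`offdiag_ne_zero_of_support_three`) the map `φ₂ ↦ M(φ₀,φ₁,φ₂)` (fibre sums = `3 × 3`
permanents) is injective, so some candidate has `M ∉ ℂ·N`, `N` the bilinear form of the `{1,2}` cut's 3-slot side
contracted with `φ₀`; LEMMA C (`bilinear_proportional`) gives `φ₃, φ₄` with `φ₃ᵀ N φ₄ = 0 ≠ φ₃ᵀ M φ₄ = per(φ)`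
(`permanent_two_slot`); `refute_of_kills` concludes.

* `triangle_case1` — configuration `(0; 0,1, 0,2, 1,2)` in the normal-form format of the residual hypothesis `hres`, plus the
  Case-1 hypothesis on `α 0`;
* `outside_case1` — configuration `(0; 0,1, 0,2, 3,4)` likewise (the cut `{3,4}` killed by the fixed form `u₂`).

HONEST FRAMING: an exact partial result toward the frontier rung `LaplaceOptimalFive` (stmt-24813), which stays OPEN (Case 2,
letter-indicator slices, remains for this configuration; three more configurations remain); nothing here bears on `VP ≠ VNP`.
-/

set_option autoImplicit false

-- the mandated summit-side namespace repeats a component by design (single-problem summit)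
set_option linter.dupNamespace false

namespace Summit.ValiantsHypothesis.ValiantsHypothesis.Theorems.RigidityForcesSymmetryRankRigidMinimalRepr

namespace LaplaceResidual

open Finset

/-- The fibre-sum matrix is linear in the third covector (scalar combination of two). -/
theorem fibre_sum_lin (φ₀ φ₁ v v' : Fin 5 → ℂ) (s t : ℂ) (x y : Fin 5) :
    (∑ σ : Equiv.Perm (Fin 5), if σ 3 = x ∧ σ 4 = y then
        φ₀ (σ 0) * φ₁ (σ 1) * (fun c => s * v c + t * v' c) (σ 2) else 0) =
      s * (∑ σ : Equiv.Perm (Fin 5), if σ 3 = x ∧ σ 4 = y then φ₀ (σ 0) * φ₁ (σ 1) * v (σ 2) else 0) +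
      t * (∑ σ : Equiv.Perm (Fin 5), if σ 3 = x ∧ σ 4 = y then φ₀ (σ 0) * φ₁ (σ 1) * v' (σ 2) else 0) := by
  rw [mul_sum, mul_sum, ← sum_add_distrib]
  refine sum_congr rfl fun σ _ => ?_
  split_ifs <;> ring

/-- **The triangle configuration, CASE 1.**  Slices `α_k(v_k) W_k(v)` on slots `0,1,2` (cofactor blind to its slot) and pair
terms on the cuts `{0,1}, {0,2}, {1,2}` never sum to the `5 × 5` permutation pattern, provided the slice vector at slot `0`
admits an orthogonal covector with all coordinates non-zero. -/
theorem triangle_case1 (α : Fin 3 → Fin 5 → ℂ) (W : Fin 3 → (Fin 5 → Fin 5) → ℂ)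
    (hW : ∀ k, ∀ v v' : Fin 5 → Fin 5, (∀ j, j ≠ (![0, 1, 2] : Fin 3 → Fin 5) k → v j = v' j) → W k v = W k v')
    (u w : Fin 3 → (Fin 5 → Fin 5) → ℂ)
    (hu : ∀ t, ∀ v v' : Fin 5 → Fin 5, v ((![0, 0, 1] : Fin 3 → Fin 5) t) = v' ((![0, 0, 1] : Fin 3 → Fin 5) t) →
      v ((![1, 2, 2] : Fin 3 → Fin 5) t) = v' ((![1, 2, 2] : Fin 3 → Fin 5) t) → u t v = u t v')
    (hw : ∀ t, ∀ v v' : Fin 5 → Fin 5, (∀ j, j ≠ (![0, 0, 1] : Fin 3 → Fin 5) t →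
      j ≠ (![1, 2, 2] : Fin 3 → Fin 5) t → v j = v' j) → w t v = w t v')
    (hfull : ∃ φ₀ : Fin 5 → ℂ, (∀ c, φ₀ c ≠ 0) ∧ ∑ c, φ₀ c * α 0 c = 0) :
    ¬ ∀ v : Fin 5 → Fin 5, (if Function.Injective v then (1 : ℂ) else 0) =
      (∑ k, α k (v ((![0, 1, 2] : Fin 3 → Fin 5) k)) * W k v) + ∑ t, u t v * w t v := by
  classical
  obtain ⟨φ₀, hφ₀, hφ₀α⟩ := hfull
  -- the constraint vectors contracted with `φ₀`
  let c0 : Fin 5 := 0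
  let μ₁ : Fin 5 → ℂ := fun y => ∑ a, φ₀ a * u 0 (Function.update (Function.update (fun _ => c0) 0 a) 1 y)
  let μ₂ : Fin 5 → ℂ := fun y => ∑ a, φ₀ a * u 1 (Function.update (Function.update (fun _ => c0) 0 a) 2 y)
  let N : Fin 5 → Fin 5 → ℂ := fun y z =>
    ∑ x, φ₀ x * w 2 (Function.update (Function.update (Function.update (fun _ => c0) 0 x) 3 y) 4 z)
  -- φ₁ : orthogonal to β and μ₁, three non-zero coordinates
  obtain ⟨φ₁, hφ₁, hsupp⟩ := LaplaceTriangular.exists_orthogonal_support_three ({α 1, μ₁} : Finset (Fin 5 → ℂ))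
    (by have := Finset.card_le_two (a := α 1) (b := μ₁); omega)
  have hφ₁β : ∑ c, φ₁ c * α 1 c = 0 := hφ₁ _ (by simp)
  have hφ₁μ : ∑ c, φ₁ c * μ₁ c = 0 := hφ₁ _ (by simp)
  have hφ₁0 : ∃ c ∈ (univ : Finset (Fin 5)), φ₁ c ≠ 0 := by
    by_contra h; push Not at h
    have : (univ.filter (fun c => φ₁ c ≠ 0)).card = 0 := by
      rw [Finset.card_eq_zero, filter_eq_empty_iff]; intro c hc; simp [h c hc]
    omega
  -- the fibre-sum matrix as a function of the third covector
  let M : (Fin 5 → ℂ) → Fin 5 → Fin 5 → ℂ := fun φ₂ x y =>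
    ∑ σ : Equiv.Perm (Fin 5), if σ 3 = x ∧ σ 4 = y then φ₀ (σ 0) * φ₁ (σ 1) * φ₂ (σ 2) else 0
  -- injectivity of `φ₂ ↦ M φ₂` (LEMMA Z + the 2 × 2 core)
  have hinj : ∀ φ₂ : Fin 5 → ℂ, (∀ x y, M φ₂ x y = 0) → φ₂ = 0 := by
    intro φ₂ hM
    have hZ := lemmaZ φ₀ φ₁ φ₂ hφ₀ (fun x y _ => hM x y)
    by_contra hne
    have hψ : ∃ c ∈ (univ : Finset (Fin 5)), φ₂ c ≠ 0 := by
      by_contra h; push Not at h; exact hne (funext fun c => by simpa using h c (mem_univ c))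
    obtain ⟨a, -, b, -, hab, hne'⟩ := LaplaceTriangular.offdiag_ne_zero_of_support_three univ φ₁ φ₂
      (by simpa using hsupp) hψ
    exact hne' (hZ a b hab)
  -- two independent candidates in V₂ = {⊥ γ, ⊥ μ₂}
  obtain ⟨v₁, hv₁0, hv₁⟩ := LaplaceTriangular.exists_ne_zero_orthogonal ({α 2, μ₂} : Finset (Fin 5 → ℂ))
    (by have := Finset.card_le_two (a := α 2) (b := μ₂); omega)
  obtain ⟨a₁, ha₁⟩ : ∃ c, v₁ c ≠ 0 := by by_contra h; push Not at h; exact hv₁0 (funext h)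
  obtain ⟨v₂, hv₂0, hv₂⟩ := LaplaceTriangular.exists_ne_zero_orthogonal
    ({α 2, μ₂, Pi.single a₁ 1} : Finset (Fin 5 → ℂ))
    (by have := Finset.card_le_three (a := α 2) (b := μ₂) (c := (Pi.single a₁ 1 : Fin 5 → ℂ)); omega)
  have hv₂a : v₂ a₁ = 0 := by simpa [Pi.single_apply] using hv₂ (Pi.single a₁ 1) (by simp)
  have hV : ∀ s t : ℂ, (∑ c, (s * v₁ c + t * v₂ c) * α 2 c = 0) ∧ (∑ c, (s * v₁ c + t * v₂ c) * μ₂ c = 0) := by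
    intro s t
    have e1 := hv₁ (α 2) (by simp); have e2 := hv₂ (α 2) (by simp)
    have e3 := hv₁ μ₂ (by simp); have e4 := hv₂ μ₂ (by simp)
    constructor
    · calc ∑ c, (s * v₁ c + t * v₂ c) * α 2 c = s * ∑ c, v₁ c * α 2 c + t * ∑ c, v₂ c * α 2 c := by
            rw [mul_sum, mul_sum, ← sum_add_distrib]; exact sum_congr rfl fun c _ => by ring
        _ = 0 := by rw [e1, e2]; ring
    · calc ∑ c, (s * v₁ c + t * v₂ c) * μ₂ c = s * ∑ c, v₁ c * μ₂ c + t * ∑ c, v₂ c * μ₂ c := by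
            rw [mul_sum, mul_sum, ← sum_add_distrib]; exact sum_congr rfl fun c _ => by ring
        _ = 0 := by rw [e3, e4]; ring
  -- independence: s v₁ + t v₂ = 0 ⇒ s = t = 0
  have hindep : ∀ s t : ℂ, (fun c => s * v₁ c + t * v₂ c) = 0 → s = 0 ∧ t = 0 := by
    intro s t hst
    have h1 := congrFun hst a₁
    simp only [hv₂a, mul_zero, add_zero, Pi.zero_apply] at h1
    have hs : s = 0 := (mul_eq_zero.mp h1).resolve_right ha₁
    refine ⟨hs, ?_⟩
    rw [hs] at hst
    by_contra ht
    apply hv₂0; funext c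
    have := congrFun hst c
    simp only [zero_mul, zero_add, Pi.zero_apply] at this
    exact (mul_eq_zero.mp this).resolve_left ht
  -- some candidate has `M ∉ ℂ·N`
  obtain ⟨φ₂, hφ₂γ, hφ₂μ, hnot⟩ : ∃ φ₂ : Fin 5 → ℂ, (∑ c, φ₂ c * α 2 c = 0) ∧ (∑ c, φ₂ c * μ₂ c = 0) ∧
      ¬ ∃ κ : ℂ, ∀ x y, M φ₂ x y = κ * N x y := by
    by_contra hall
    push Not at hall
    obtain ⟨κ₁, hκ₁⟩ := hall v₁ (by simpa using (hV 1 0).1) (by simpa using (hV 1 0).2)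
    obtain ⟨κ₂, hκ₂⟩ := hall v₂ (by simpa using (hV 0 1).1) (by simpa using (hV 0 1).2)
    -- w := κ₁ v₂ - κ₂ v₁ has M w = 0, hence w = 0, hence κ₁ = κ₂ = 0, hence M v₁ = 0, hence v₁ = 0
    have hMw : ∀ x y, M (fun c => (-κ₂) * v₁ c + κ₁ * v₂ c) x y = 0 := by
      intro x y
      have hlin : M (fun c => (-κ₂) * v₁ c + κ₁ * v₂ c) x y = (-κ₂) * M v₁ x y + κ₁ * M v₂ x y :=
        fibre_sum_lin φ₀ φ₁ v₁ v₂ (-κ₂) κ₁ x y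
      rw [hlin, hκ₁ x y, hκ₂ x y]; ring
    have hw0 := hinj (fun c => (-κ₂) * v₁ c + κ₁ * v₂ c) hMw
    obtain ⟨hk2, hk1⟩ := hindep (-κ₂) κ₁ hw0
    have hM1 : ∀ x y, M v₁ x y = 0 := fun x y => by rw [hκ₁ x y, hk1, zero_mul]
    exact hv₁0 (hinj v₁ hM1)
  -- LEMMA C: covectors for the last two slots
  obtain ⟨φ₃, φ₄, hN0, hM0⟩ : ∃ φ₃ φ₄ : Fin 5 → ℂ, (∑ i, ∑ j, φ₃ i * N i j * φ₄ j) = 0 ∧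
      (∑ i, ∑ j, φ₃ i * M φ₂ i j * φ₄ j) ≠ 0 := by
    by_contra h
    push Not at h
    exact hnot (bilinear_proportional (M φ₂) N h)
  -- the witness
  let φ : Fin 5 → Fin 5 → ℂ := ![φ₀, φ₁, φ₂, φ₃, φ₄]
  have hφ0 : φ 0 = φ₀ := rfl
  have hφ1 : φ 1 = φ₁ := rfl
  have hφ2 : φ 2 = φ₂ := rfl
  have hφ3 : φ 3 = φ₃ := rfl
  have hφ4 : φ 4 = φ₄ := rfl
  have hper : (Matrix.of fun c s => φ s c).permanent ≠ 0 := by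
    rw [permanent_two_slot φ, hφ0, hφ1, hφ2, hφ3, hφ4]
    exact hM0
  refine LaplaceFiveSlices.refute_of_kills ![0, 1, 2] α W hW ![0, 0, 1] ![1, 2, 2] (by decide) u w hu hw
    ![false, false, true] ![1, 2, 4] ![0, 0, 0] ![0, 0, 0] ![0, 0, 3] ?_ ?_ φ hper ?_ ?_ ?_
  · intro t ht; fin_cases t
    · right; exact ⟨rfl, rfl⟩
    · right; exact ⟨rfl, rfl⟩
    · exact absurd ht (by decide)
  · intro t ht; fin_cases t
    · exact absurd ht (by decide)
    · exact absurd ht (by decide)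
    · decide
  · intro k; fin_cases k
    · exact hφ₀α
    · exact hφ₁β
    · exact hφ₂γ
  · intro t ht; fin_cases t
    · -- cut {0,1}, charged at slot 1
      show ∑ y, φ 1 y * ∑ a, φ 0 a * u 0 (Function.update (Function.update (fun _ => (0 : Fin 5)) 0 a) 1 y) = 0
      rw [hφ0, hφ1]; exact hφ₁μ
    · show ∑ y, φ 2 y * ∑ a, φ 0 a * u 1 (Function.update (Function.update (fun _ => (0 : Fin 5)) 0 a) 2 y) = 0
      rw [hφ0, hφ2]; exact hφ₂μ
    · exact absurd ht (by decide)
  · intro t ht; fin_cases t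
    · exact absurd ht (by decide)
    · exact absurd ht (by decide)
    · show ∑ z, φ 4 z * ∑ xy : Fin 5 × Fin 5, φ 0 xy.1 * φ 3 xy.2 *
          w 2 (Function.update (Function.update (Function.update (fun _ => (0 : Fin 5)) 0 xy.1) 3 xy.2) 4 z) = 0
      rw [hφ0, hφ3, hφ4, ← hN0]
      simp only [N, Fintype.sum_prod_type, Fin.sum_univ_five]
      ring

/-- **The «two inside + outside» configuration `(0; 01, 02, 34)`, CASE 1.**  Slices on slots `0,1,2` and pair terms on the
cuts `{0,1}, {0,2}, {3,4}` never sum to the `5 × 5` permutation pattern, provided the slice vector at slot `0` admits an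
orthogonal covector with all coordinates non-zero (the cut `{3,4}` is killed on its 2-slot side by a FIXED bilinear form). -/
theorem outside_case1 (α : Fin 3 → Fin 5 → ℂ) (W : Fin 3 → (Fin 5 → Fin 5) → ℂ)
    (hW : ∀ k, ∀ v v' : Fin 5 → Fin 5, (∀ j, j ≠ (![0, 1, 2] : Fin 3 → Fin 5) k → v j = v' j) → W k v = W k v')
    (u w : Fin 3 → (Fin 5 → Fin 5) → ℂ)
    (hu : ∀ t, ∀ v v' : Fin 5 → Fin 5, v ((![0, 0, 3] : Fin 3 → Fin 5) t) = v' ((![0, 0, 3] : Fin 3 → Fin 5) t) →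
      v ((![1, 2, 4] : Fin 3 → Fin 5) t) = v' ((![1, 2, 4] : Fin 3 → Fin 5) t) → u t v = u t v')
    (hw : ∀ t, ∀ v v' : Fin 5 → Fin 5, (∀ j, j ≠ (![0, 0, 3] : Fin 3 → Fin 5) t →
      j ≠ (![1, 2, 4] : Fin 3 → Fin 5) t → v j = v' j) → w t v = w t v')
    (hfull : ∃ φ₀ : Fin 5 → ℂ, (∀ c, φ₀ c ≠ 0) ∧ ∑ c, φ₀ c * α 0 c = 0) :
    ¬ ∀ v : Fin 5 → Fin 5, (if Function.Injective v then (1 : ℂ) else 0) =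
      (∑ k, α k (v ((![0, 1, 2] : Fin 3 → Fin 5) k)) * W k v) + ∑ t, u t v * w t v := by
  classical
  obtain ⟨φ₀, hφ₀, hφ₀α⟩ := hfull
  -- the constraint vectors contracted with `φ₀`
  let c0 : Fin 5 := 0
  let μ₁ : Fin 5 → ℂ := fun y => ∑ a, φ₀ a * u 0 (Function.update (Function.update (fun _ => c0) 0 a) 1 y)
  let μ₂ : Fin 5 → ℂ := fun y => ∑ a, φ₀ a * u 1 (Function.update (Function.update (fun _ => c0) 0 a) 2 y)
  let N : Fin 5 → Fin 5 → ℂ := fun y z => u 2 (Function.update (Function.update (fun _ => c0) 3 y) 4 z)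
  -- φ₁ : orthogonal to β and μ₁, three non-zero coordinates
  obtain ⟨φ₁, hφ₁, hsupp⟩ := LaplaceTriangular.exists_orthogonal_support_three ({α 1, μ₁} : Finset (Fin 5 → ℂ))
    (by have := Finset.card_le_two (a := α 1) (b := μ₁); omega)
  have hφ₁β : ∑ c, φ₁ c * α 1 c = 0 := hφ₁ _ (by simp)
  have hφ₁μ : ∑ c, φ₁ c * μ₁ c = 0 := hφ₁ _ (by simp)
  have hφ₁0 : ∃ c ∈ (univ : Finset (Fin 5)), φ₁ c ≠ 0 := by
    by_contra h; push Not at h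
    have : (univ.filter (fun c => φ₁ c ≠ 0)).card = 0 := by
      rw [Finset.card_eq_zero, filter_eq_empty_iff]; intro c hc; simp [h c hc]
    omega
  -- the fibre-sum matrix as a function of the third covector
  let M : (Fin 5 → ℂ) → Fin 5 → Fin 5 → ℂ := fun φ₂ x y =>
    ∑ σ : Equiv.Perm (Fin 5), if σ 3 = x ∧ σ 4 = y then φ₀ (σ 0) * φ₁ (σ 1) * φ₂ (σ 2) else 0
  -- injectivity of `φ₂ ↦ M φ₂` (LEMMA Z + the 2 × 2 core)
  have hinj : ∀ φ₂ : Fin 5 → ℂ, (∀ x y, M φ₂ x y = 0) → φ₂ = 0 := by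
    intro φ₂ hM
    have hZ := lemmaZ φ₀ φ₁ φ₂ hφ₀ (fun x y _ => hM x y)
    by_contra hne
    have hψ : ∃ c ∈ (univ : Finset (Fin 5)), φ₂ c ≠ 0 := by
      by_contra h; push Not at h; exact hne (funext fun c => by simpa using h c (mem_univ c))
    obtain ⟨a, -, b, -, hab, hne'⟩ := LaplaceTriangular.offdiag_ne_zero_of_support_three univ φ₁ φ₂
      (by simpa using hsupp) hψ
    exact hne' (hZ a b hab)
  -- two independent candidates in V₂ = {⊥ γ, ⊥ μ₂}
  obtain ⟨v₁, hv₁0, hv₁⟩ := LaplaceTriangular.exists_ne_zero_orthogonal ({α 2, μ₂} : Finset (Fin 5 → ℂ))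
    (by have := Finset.card_le_two (a := α 2) (b := μ₂); omega)
  obtain ⟨a₁, ha₁⟩ : ∃ c, v₁ c ≠ 0 := by by_contra h; push Not at h; exact hv₁0 (funext h)
  obtain ⟨v₂, hv₂0, hv₂⟩ := LaplaceTriangular.exists_ne_zero_orthogonal
    ({α 2, μ₂, Pi.single a₁ 1} : Finset (Fin 5 → ℂ))
    (by have := Finset.card_le_three (a := α 2) (b := μ₂) (c := (Pi.single a₁ 1 : Fin 5 → ℂ)); omega)
  have hv₂a : v₂ a₁ = 0 := by simpa [Pi.single_apply] using hv₂ (Pi.single a₁ 1) (by simp)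
  have hV : ∀ s t : ℂ, (∑ c, (s * v₁ c + t * v₂ c) * α 2 c = 0) ∧ (∑ c, (s * v₁ c + t * v₂ c) * μ₂ c = 0) := by
    intro s t
    have e1 := hv₁ (α 2) (by simp); have e2 := hv₂ (α 2) (by simp)
    have e3 := hv₁ μ₂ (by simp); have e4 := hv₂ μ₂ (by simp)
    constructor
    · calc ∑ c, (s * v₁ c + t * v₂ c) * α 2 c = s * ∑ c, v₁ c * α 2 c + t * ∑ c, v₂ c * α 2 c := by
            rw [mul_sum, mul_sum, ← sum_add_distrib]; exact sum_congr rfl fun c _ => by ring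
        _ = 0 := by rw [e1, e2]; ring
    · calc ∑ c, (s * v₁ c + t * v₂ c) * μ₂ c = s * ∑ c, v₁ c * μ₂ c + t * ∑ c, v₂ c * μ₂ c := by
            rw [mul_sum, mul_sum, ← sum_add_distrib]; exact sum_congr rfl fun c _ => by ring
        _ = 0 := by rw [e3, e4]; ring
  -- independence: s v₁ + t v₂ = 0 ⇒ s = t = 0
  have hindep : ∀ s t : ℂ, (fun c => s * v₁ c + t * v₂ c) = 0 → s = 0 ∧ t = 0 := by
    intro s t hst
    have h1 := congrFun hst a₁
    simp only [hv₂a, mul_zero, add_zero, Pi.zero_apply] at h1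
    have hs : s = 0 := (mul_eq_zero.mp h1).resolve_right ha₁
    refine ⟨hs, ?_⟩
    rw [hs] at hst
    by_contra ht
    apply hv₂0; funext c
    have := congrFun hst c
    simp only [zero_mul, zero_add, Pi.zero_apply] at this
    exact (mul_eq_zero.mp this).resolve_left ht
  -- some candidate has `M ∉ ℂ·N`
  obtain ⟨φ₂, hφ₂γ, hφ₂μ, hnot⟩ : ∃ φ₂ : Fin 5 → ℂ, (∑ c, φ₂ c * α 2 c = 0) ∧ (∑ c, φ₂ c * μ₂ c = 0) ∧
      ¬ ∃ κ : ℂ, ∀ x y, M φ₂ x y = κ * N x y := by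
    by_contra hall
    push Not at hall
    obtain ⟨κ₁, hκ₁⟩ := hall v₁ (by simpa using (hV 1 0).1) (by simpa using (hV 1 0).2)
    obtain ⟨κ₂, hκ₂⟩ := hall v₂ (by simpa using (hV 0 1).1) (by simpa using (hV 0 1).2)
    -- w := κ₁ v₂ - κ₂ v₁ has M w = 0, hence w = 0, hence κ₁ = κ₂ = 0, hence M v₁ = 0, hence v₁ = 0
    have hMw : ∀ x y, M (fun c => (-κ₂) * v₁ c + κ₁ * v₂ c) x y = 0 := by
      intro x y
      have hlin : M (fun c => (-κ₂) * v₁ c + κ₁ * v₂ c) x y = (-κ₂) * M v₁ x y + κ₁ * M v₂ x y :=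
        fibre_sum_lin φ₀ φ₁ v₁ v₂ (-κ₂) κ₁ x y
      rw [hlin, hκ₁ x y, hκ₂ x y]; ring
    have hw0 := hinj (fun c => (-κ₂) * v₁ c + κ₁ * v₂ c) hMw
    obtain ⟨hk2, hk1⟩ := hindep (-κ₂) κ₁ hw0
    have hM1 : ∀ x y, M v₁ x y = 0 := fun x y => by rw [hκ₁ x y, hk1, zero_mul]
    exact hv₁0 (hinj v₁ hM1)
  -- LEMMA C: covectors for the last two slots
  obtain ⟨φ₃, φ₄, hN0, hM0⟩ : ∃ φ₃ φ₄ : Fin 5 → ℂ, (∑ i, ∑ j, φ₃ i * N i j * φ₄ j) = 0 ∧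
      (∑ i, ∑ j, φ₃ i * M φ₂ i j * φ₄ j) ≠ 0 := by
    by_contra h
    push Not at h
    exact hnot (bilinear_proportional (M φ₂) N h)
  -- the witness
  let φ : Fin 5 → Fin 5 → ℂ := ![φ₀, φ₁, φ₂, φ₃, φ₄]
  have hφ0 : φ 0 = φ₀ := rfl
  have hφ1 : φ 1 = φ₁ := rfl
  have hφ2 : φ 2 = φ₂ := rfl
  have hφ3 : φ 3 = φ₃ := rfl
  have hφ4 : φ 4 = φ₄ := rfl
  have hper : (Matrix.of fun c s => φ s c).permanent ≠ 0 := by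
    rw [permanent_two_slot φ, hφ0, hφ1, hφ2, hφ3, hφ4]
    exact hM0
  refine LaplaceFiveSlices.refute_of_kills ![0, 1, 2] α W hW ![0, 0, 3] ![1, 2, 4] (by decide) u w hu hw
    ![false, false, false] ![1, 2, 4] ![0, 0, 3] ![0, 0, 0] ![0, 0, 0] ?_ ?_ φ hper ?_ ?_ ?_
  · intro t ht; fin_cases t
    · right; exact ⟨rfl, rfl⟩
    · right; exact ⟨rfl, rfl⟩
    · right; exact ⟨rfl, rfl⟩
  · intro t ht; fin_cases t
    · exact absurd ht (by decide)
    · exact absurd ht (by decide)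
    · exact absurd ht (by decide)
  · intro k; fin_cases k
    · exact hφ₀α
    · exact hφ₁β
    · exact hφ₂γ
  · intro t ht; fin_cases t
    · -- cut {0,1}, charged at slot 1
      show ∑ y, φ 1 y * ∑ a, φ 0 a * u 0 (Function.update (Function.update (fun _ => (0 : Fin 5)) 0 a) 1 y) = 0
      rw [hφ0, hφ1]; exact hφ₁μ
    · show ∑ y, φ 2 y * ∑ a, φ 0 a * u 1 (Function.update (Function.update (fun _ => (0 : Fin 5)) 0 a) 2 y) = 0
      rw [hφ0, hφ2]; exact hφ₂μ
    · show ∑ y, φ 4 y * ∑ a, φ 3 a * u 2 (Function.update (Function.update (fun _ => (0 : Fin 5)) 3 a) 4 y) = 0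
      rw [hφ3, hφ4, ← hN0]
      simp only [N, Fin.sum_univ_five]
      ring
  · intro t ht; fin_cases t
    · exact absurd ht (by decide)
    · exact absurd ht (by decide)
    · exact absurd ht (by decide)

end LaplaceResidual

end Summit.ValiantsHypothesis.ValiantsHypothesis.Theorems.RigidityForcesSymmetryRankRigidMinimalRepr
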